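import Summits.Ventures.HodgeRepro.Night4KnownRegime
import Summits.Ventures.HodgeRepro.NightOpenInputs

/-!
# The Fermat-type row of ROUTE.md §3.0 (L4.6) as a theorem with printed hypotheses: Shioda 1979 / Aoki 1987 through da Silva's survey

Blind re-derivation cell `pub-hodge-repro`, seat `night-4` (ROUTE HARDENING for the Monday FINAL, gen 2).  Target tree path
`lean/Summits/Ventures/HodgeRepro/Night4FermatType.lean`.

ROUTE.md §1 row S4 / §3.0 list among the CLOSED sub-loci of S4 «L4.6 (Fermat type of degree m < 21, m prime, m = p² —
Shioda 1979 / Aoki 1987)», and §7 item 3 (p4's C3-FERMAT) uses it at the census fields ℚ(ζ₁₅), ℚ(ζ₁₆), ℚ(ζ₂₀).  The cell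
holds these results only AS RESTATED by da Silva Jr., *Known cases of the Hodge conjecture*, arXiv:2105.04695 (survey, 2021),
store `paper:arxiv-2105.04695` p0006 (read by the seat 2026-08-24T07:49Z; the primaries Shioda, Math. Ann. 245 (1979) and
Aoki 1987 are NOT held — route/SOURCES.md row dS1).  This file types them verbatim as named hypotheses over an abstract
interface and proves the route's row from them:

* `Shioda_2_25` («The Hodge conjecture is true for Fermat varieties `X^n_m` with degree less than 21», p0006:L6–7),
  `Shioda_Ran_2_26` (L11–12), `Aoki_2_28` (L21–22), Definition 2.29 (`IsFermatType`, L28–29, an abstract predicate),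
  `Shioda_2_30` («If the Hodge conjecture is true for the Fermat `X^n_m` regardless of `n`, then it's true for any abelian
  variety `A` of Fermat type of degree `m`», L33–34);
* `HC_of_isFermatType_lt_21 : Shioda_2_25 → Shioda_2_30 → ∀ m < 21, ∀ A of Fermat type of degree m, HC(A)` and the
  `m = p²` / `m` prime versions; `S4_fermat_of_Shioda`: the Weil line of a split-Weil corner product of Fermat type is
  algebraic; `S0_of_isFermatType`: HC for the CM abelian varieties of Fermat type (the row's claim).

The dictionary clause `CornerFermat` (a corner product of a CM abelian variety whose corners are of Fermat type of degree
`m` is of Fermat type of degree `m` — products and powers of Jacobian factors dominated by `X¹_m`, Definition 2.29) is the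
cell's reading, named as such.  NO open input is closed; HC_CM is NOT proved; nothing here asserts anything about the
original programme.
-/

namespace HodgeRepro.Route

/-- **The interface**: `KnownRegimeData` with the Fermat varieties and the predicate of Definition 2.29.  The fields assert
nothing: `Fermat n m` is the Fermat variety `X^n_m ⊂ ℙ^{n+1}`, «the zeros of `x_0^m + … + x_{n+1}^m = 0`» (da Silva
p0005:L80–82); `IsFermatType m A` is «`A` is of Fermat type of degree `m`»; `IsFermatTypeCM m A` is the cell's reading of
§7 item 3's type-level criterion (Dolgachev–Zarhin Ex. 9.12 / Koblitz–Rohrlich: the CM type of `A` lifts to a Galois twist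
of a Jacobi-sum type `H_{a,b,c}` of degree `m`, so that each corner `A ⊗_{E,s} F` is isogenous to a power of a simple
factor of `J(X¹_m)`). -/
structure FermatTypeData extends KnownRegimeData where
  /-- the Fermat variety `X^n_m` of dimension `n` and degree `m` -/
  Fermat : ℕ → ℕ → Var
  /-- **Definition 2.29** (da Silva, store p0006:L28–29, verbatim): «An abelian variety `A` is said to be of Fermat type
  of degree `m` if it is isogeneous to a product `J_1 × … × J_k` of Jacobian of curves dominated by the Fermat curve
  `X^1_m`.» -/
  IsFermatType : ℕ → Var → Prop
  /-- the CM abelian varieties whose corners are of Fermat type of degree `m` (the cell's reading of the type-level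
  criterion; an abstract predicate) -/
  IsFermatTypeCM : ℕ → Var → Prop

variable (𝓕 : FermatTypeData)

/-- **The Hodge conjecture for one variety**: every Hodge class of every codimension is algebraic. -/
def HCvar (X : 𝓕.Var) : Prop :=
  ∀ p : ℕ, 𝓕.hodge p X ≤ 𝓕.alg p X

/-- **Theorem 2.25 (Shioda [shioda3])** — da Silva, store p0006:L6–7, verbatim: «The Hodge conjeture [sic] is true for
Fermat varieties `X^n_m` with degree less than `21`.»  PRINTED (as restated by the survey; the primary Shioda 1979 not
held). -/
def Shioda_2_25 : Prop :=
  ∀ n m : ℕ, m < 21 → HCvar 𝓕 (𝓕.Fermat n m)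

/-- **Theorem 2.26 (Shioda, Ran [shioda3, ran])** — store p0006:L11–12, verbatim: «If `m` is prime or `m = 4`, the
cohomology ring of `X^n_m` is generated by linear subspaces, thus the Hodge conjecture is true for `X^n_m`.»  Typed by its
conclusion.  PRINTED (survey). -/
def Shioda_Ran_2_26 : Prop :=
  ∀ n m : ℕ, (m.Prime ∨ m = 4) → HCvar 𝓕 (𝓕.Fermat n m)

/-- **Theorem 2.28 (Aoki [aoki])** — store p0006:L21–22, verbatim: «The Hodge conjecture is true for `X^n_{p²}`, `p`
prime.»  PRINTED (survey; the primary Aoki 1987 not held). -/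
def Aoki_2_28 : Prop :=
  ∀ n p : ℕ, p.Prime → HCvar 𝓕 (𝓕.Fermat n (p ^ 2))

/-- **Theorem 2.30 (Shioda, [shioda3])** — store p0006:L33–34, verbatim: «If the Hodge conjecture is true for the Fermat
`X^n_m` regardless of `n`, then it's true for any abelian variety `A` of Fermat type of degree `m`.»  Proof as printed
(L36–37): «by definition of Jacobian, we can find a morphism of finite degree `f : X^1_m × … × X^1_m → A`. Now the Hodge
conjecture is true for the product `X^1_m × … × X^1_m` [shioda3]. The result then follows from lemma (fin_d).»  PRINTED
(survey). -/
def Shioda_2_30 : Prop :=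
  ∀ m : ℕ, (∀ n : ℕ, HCvar 𝓕 (𝓕.Fermat n m)) → ∀ A : 𝓕.Var, 𝓕.IsFermatType m A → HCvar 𝓕 A

/-- **The corner products of a Fermat-type CM abelian variety are of Fermat type** — the cell's dictionary clause: if the
corners `A ⊗_{E,s} F` of `A` are isogenous to powers of simple factors of `J(X¹_m)` (`IsFermatTypeCM m A`), then every
corner product `A_Δ = ∏_{s∈Δ} A_s` is isogenous to a product of Jacobian factors dominated by `X¹_m`, i.e. is of Fermat
type of degree `m` (Definition 2.29).  UNPRINTED as a sentence (the cell's reading of §7 item 3). -/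
def CornerFermat : Prop :=
  ∀ (m : ℕ) (A : 𝓕.Var), 𝓕.IsCM A → 𝓕.IsFermatTypeCM m A →
    ∀ Δ : Finset (𝓕.typeOf A).S, 𝓕.IsFermatType m (𝓕.corner A Δ)

/-- **HC for the abelian varieties of Fermat type of degree `m < 21`** (Shioda 2.25 + 2.30). -/
theorem HC_of_isFermatType_lt_21 (h25 : Shioda_2_25 𝓕) (h30 : Shioda_2_30 𝓕) {m : ℕ} (hm : m < 21)
    {A : 𝓕.Var} (hA : 𝓕.IsFermatType m A) : HCvar 𝓕 A :=
  h30 m (fun n => h25 n m hm) A hA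

/-- **HC for the abelian varieties of Fermat type of prime-square degree** (Aoki 2.28 + Shioda 2.30). -/
theorem HC_of_isFermatType_primeSq (h28 : Aoki_2_28 𝓕) (h30 : Shioda_2_30 𝓕) {p : ℕ} (hp : p.Prime)
    {A : 𝓕.Var} (hA : 𝓕.IsFermatType (p ^ 2) A) : HCvar 𝓕 A :=
  h30 (p ^ 2) (fun n => h28 n p hp) A hA

/-- **HC for the abelian varieties of Fermat type of prime degree or degree 4** (Shioda–Ran 2.26 + Shioda 2.30). -/
theorem HC_of_isFermatType_prime (h26 : Shioda_Ran_2_26 𝓕) (h30 : Shioda_2_30 𝓕) {m : ℕ} (hm : m.Prime ∨ m = 4)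
    {A : 𝓕.Var} (hA : 𝓕.IsFermatType m A) : HCvar 𝓕 A :=
  h30 m (fun n => h26 n m hm) A hA

/-- **ROUTE.md §3.0 row L4.6 — S0 for the CM abelian varieties of Fermat type** of degree `m < 21`: every Hodge class is
algebraic (Shioda 2.25 + 2.30; here `A` itself is of Fermat type). -/
theorem S0_of_isFermatType (h25 : Shioda_2_25 𝓕) (h30 : Shioda_2_30 𝓕) {m : ℕ} (hm : m < 21) {A : 𝓕.Var}
    (hA : 𝓕.IsFermatType m A) (p : ℕ) : 𝓕.hodge p A ≤ 𝓕.alg p A :=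
  HC_of_isFermatType_lt_21 𝓕 h25 h30 hm hA p

/-- **S4 on the corner products of Fermat type** (§3.0 / §7 item 3: the census faces on ℚ(ζ₁₅), ℚ(ζ₁₆), ℚ(ζ₂₀)): for a
CM abelian variety `A` of Fermat-type CM (`IsFermatTypeCM m A`, `m < 21`) and every `Δ` satisfying (eq2), the Weil line
`W_F(A_Δ)` consists of Hodge classes (`S1` + `WeilIsHodge`, Deligne §5 (c)) on the Fermat-type variety `A_Δ`
(`CornerFermat`), which are algebraic by Shioda 2.25 + 2.30. -/
theorem S4_fermat_of_Shioda (h25 : Shioda_2_25 𝓕) (h30 : Shioda_2_30 𝓕) (hC : CornerFermat 𝓕)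
    (h1 : S1 𝓕.toRouteData) (hW : WeilIsHodge 𝓕.toRouteData) {m : ℕ} (hm : m < 21) {A : 𝓕.Var} (hA : 𝓕.IsCM A)
    (hF : 𝓕.IsFermatTypeCM m A) (p : ℕ) (Δ : Finset (𝓕.typeOf A).S) (hΔ : (𝓕.typeOf A).Eq2 p Δ) :
    𝓕.weil p (𝓕.corner A Δ) ≤ 𝓕.alg p (𝓕.corner A Δ) :=
  (hW p _ (h1 A hA p Δ hΔ)).trans (HC_of_isFermatType_lt_21 𝓕 h25 h30 hm (hC m A hA hF Δ) p)

/-- **The faces of Fermat type are closed** — the instance of `S4_fermat_of_Shioda` at `p = 2` on the roster's faces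
(`IsFace`, whose second clause is (eq2) at `p = 2`): the form `S4faces` restricted to Fermat-type CM varieties. -/
theorem S4faces_fermat_of_Shioda (h25 : Shioda_2_25 𝓕) (h30 : Shioda_2_30 𝓕) (hC : CornerFermat 𝓕)
    (h1 : S1 𝓕.toRouteData) (hW : WeilIsHodge 𝓕.toRouteData) {m : ℕ} (hm : m < 21) {A : 𝓕.Var} (hA : 𝓕.IsCM A)
    (hF : 𝓕.IsFermatTypeCM m A) (Δ : Finset (𝓕.typeOf A).S) (hΔ : (𝓕.typeOf A).IsFace Δ) :
    𝓕.weil 2 (𝓕.corner A Δ) ≤ 𝓕.alg 2 (𝓕.corner A Δ) :=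
  S4_fermat_of_Shioda 𝓕 h25 h30 hC h1 hW hm hA hF 2 Δ hΔ.2.1

end HodgeRepro.Route
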